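import Mathlib
import Summits.Ventures.HodgeRepro.ZariskiDense

/-!
# A separating element: `K^×` separates finitely many monomials in the embeddings (ROUTE.md A5 (1))

ROUTE.md Appendix A5 (1) says: "`a^*` acts on `H_M` by the character `χ_M(a) = ∏_{s ∈ M} s(a)`;
distinct `M` give distinct characters, because `F^×` is Zariski-dense in `(F ⊗ ℂ)^× = ∏_s ℂ^×` and
distinct monomials differ on the torus", and then uses ONE `a` with pairwise distinct values
`χ_M(a)` (Lagrange interpolation in `a^*`).  This file kernel-checks that sentence for a number
field `K`, on top of `ZariskiDense.exists_eval_embeddings_ne_zero`: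

* `exists_separating_finsupp` — for finitely many pairwise distinct exponent vectors
  `e : Hom(K,ℂ) →₀ ℕ` there is `a ∈ K` with the monomial values `∏_σ σ(a)^{e σ}` pairwise distinct;
* `prod_map_eq_prod_toFinsupp` — the character of a multiset `M` of embeddings,
  `χ_M(a) = ∏_{σ ∈ M} σ(a)` (with multiplicity), is the monomial value of its exponent vector;
* **`exists_separating_multiset`** — finitely many distinct multisets `M` of embeddings (the
  "multisets of `2p` embeddings" of A5) have pairwise distinct characters `χ_M(a)` at one `a ∈ K`;
* `exists_separating_finsupp_pi` / `prod_sum_single_eq_prod` / `sum_single_injective` /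
  **`exists_separating_tuple`** — the same for `m` copies: finitely many distinct tuples
  `s : Fin m → Hom(K,ℂ)` (the characters `∏ᵢ sᵢ(aᵢ)` of `(K^×)^m` — S3ᴿ's "separating
  correspondence") take pairwise distinct values at one `a : Fin m → K`;
* `exists_separating_multiset_coprime` / `exists_separating_tuple_coprime` — at that `a` the linear
  factors `X − χ(a)` are pairwise coprime in `ℂ[X]`, the input shape of
  `Isotypic.exists_partition_of_unity`.

Mathlib only beyond `ZariskiDense`.  Nothing here says anything about the status of the Hodge
conjecture for CM abelian varieties.
-/

namespace HodgeRepro.Zariski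

open MvPolynomial Module

variable (K : Type*) [Field K] [NumberField K]

/-- **A separating element for finitely many monomials.**  For a finite set `S` of exponent vectors
`e : Hom(K,ℂ) →₀ ℕ` there is `a ∈ K` such that distinct `e₁, e₂ ∈ S` have distinct monomial values
`∏_σ σ(a)^{e₁ σ} ≠ ∏_σ σ(a)^{e₂ σ}`: the product over the distinct pairs of
`X^{e₁} - X^{e₂}` is a non-zero polynomial on `ℂ^{Hom(K,ℂ)}`, hence non-zero at some `(σ(a))_σ`. -/
theorem exists_separating_finsupp (S : Finset ((K →ₐ[ℚ] ℂ) →₀ ℕ)) :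
    ∃ a : K, ∀ e₁ ∈ S, ∀ e₂ ∈ S, e₁ ≠ e₂ →
      (e₁.prod fun σ n => σ a ^ n) ≠ e₂.prod fun σ n => σ a ^ n := by
  classical
  set D := (S ×ˢ S).filter fun q => q.1 ≠ q.2 with hD
  set P : MvPolynomial (K →ₐ[ℚ] ℂ) ℂ :=
    ∏ q ∈ D, (monomial q.1 (1 : ℂ) - monomial q.2 (1 : ℂ)) with hP
  have hP0 : P ≠ 0 := by
    rw [hP]
    refine Finset.prod_ne_zero_iff.mpr fun q hq => ?_
    have hne : q.1 ≠ q.2 := (Finset.mem_filter.mp hq).2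
    intro h
    have h' := congrArg (coeff q.1) (sub_eq_zero.mp h)
    simp [coeff_monomial, hne.symm] at h'
  obtain ⟨a, ha⟩ := exists_eval_embeddings_ne_zero K P hP0
  refine ⟨a, fun e₁ h₁ e₂ h₂ hne => ?_⟩
  have hmem : (e₁, e₂) ∈ D := by
    rw [hD, Finset.mem_filter, Finset.mem_product]
    exact ⟨⟨h₁, h₂⟩, hne⟩
  rw [hP, map_prod] at ha
  have hq := Finset.prod_ne_zero_iff.mp ha (e₁, e₂) hmem
  rw [map_sub, eval_monomial, eval_monomial, one_mul, one_mul] at hq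
  exact sub_ne_zero.mp hq

/-- The character of a multiset of embeddings, `χ_M(a) = ∏_{σ ∈ M} σ(a)` with multiplicity, is the
monomial value of its exponent vector `Multiset.toFinsupp M` (`σ ↦ count σ M`). -/
theorem prod_map_eq_prod_toFinsupp [DecidableEq (K →ₐ[ℚ] ℂ)] (M : Multiset (K →ₐ[ℚ] ℂ)) (a : K) :
    (M.map fun σ => σ a).prod = (Multiset.toFinsupp M).prod fun σ n => σ a ^ n := by
  rw [Finset.prod_multiset_map_count]
  simp only [Finsupp.prod, Multiset.toFinsupp_support, Multiset.toFinsupp_apply]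

/-- **Distinct multisets of embeddings have distinct characters at one rational point
(ROUTE.md A5 (1)).**  For a finite set `𝓜` of multisets of embeddings `K → ℂ` there is `a ∈ K` such
that `M ≠ N` in `𝓜` implies `χ_M(a) = ∏_{σ ∈ M} σ(a) ≠ ∏_{σ ∈ N} σ(a) = χ_N(a)`. -/
theorem exists_separating_multiset [DecidableEq (K →ₐ[ℚ] ℂ)]
    (𝓜 : Finset (Multiset (K →ₐ[ℚ] ℂ))) :
    ∃ a : K, ∀ M ∈ 𝓜, ∀ N ∈ 𝓜, M ≠ N →
      (M.map fun σ => σ a).prod ≠ (N.map fun σ => σ a).prod := by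
  obtain ⟨a, ha⟩ := exists_separating_finsupp K (𝓜.image Multiset.toFinsupp)
  refine ⟨a, fun M hM N hN hMN => ?_⟩
  rw [prod_map_eq_prod_toFinsupp, prod_map_eq_prod_toFinsupp]
  exact ha _ (Finset.mem_image_of_mem _ hM) _ (Finset.mem_image_of_mem _ hN)
    fun h => hMN (Multiset.toFinsupp.injective h)

/-- **Several copies** (the shape `(K^×)^m` of ROUTE.md S3ᴿ / A5 (1) for `m` corners over one field):
for finitely many distinct exponent vectors `e : Fin m × Hom(K,ℂ) →₀ ℕ` there is `a : Fin m → K`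
with the monomial values `∏_{(i,σ)} σ(a i)^{e (i,σ)}` pairwise distinct. -/
theorem exists_separating_finsupp_pi (m : ℕ) (S : Finset (Fin m × (K →ₐ[ℚ] ℂ) →₀ ℕ)) :
    ∃ a : Fin m → K, ∀ e₁ ∈ S, ∀ e₂ ∈ S, e₁ ≠ e₂ →
      (e₁.prod fun q n => q.2 (a q.1) ^ n) ≠ e₂.prod fun q n => q.2 (a q.1) ^ n := by
  classical
  set D := (S ×ˢ S).filter fun q => q.1 ≠ q.2 with hD
  set P : MvPolynomial (Fin m × (K →ₐ[ℚ] ℂ)) ℂ :=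
    ∏ q ∈ D, (monomial q.1 (1 : ℂ) - monomial q.2 (1 : ℂ)) with hP
  have hP0 : P ≠ 0 := by
    rw [hP]
    refine Finset.prod_ne_zero_iff.mpr fun q hq => ?_
    have hne : q.1 ≠ q.2 := (Finset.mem_filter.mp hq).2
    intro h
    have h' := congrArg (coeff q.1) (sub_eq_zero.mp h)
    simp [coeff_monomial, hne.symm] at h'
  obtain ⟨a, ha⟩ := exists_eval_embeddings_pi_ne_zero K m P hP0
  refine ⟨a, fun e₁ h₁ e₂ h₂ hne => ?_⟩
  have hmem : (e₁, e₂) ∈ D := by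
    rw [hD, Finset.mem_filter, Finset.mem_product]
    exact ⟨⟨h₁, h₂⟩, hne⟩
  rw [hP, map_prod] at ha
  have hq := Finset.prod_ne_zero_iff.mp ha (e₁, e₂) hmem
  rw [map_sub, eval_monomial, eval_monomial, one_mul, one_mul] at hq
  exact sub_ne_zero.mp hq

/-- The exponent vector of a tuple of embeddings `s : Fin m → Hom(K,ℂ)` is `∑ i, single (i, s i) 1`;
its monomial value at `a : Fin m → K` is the character value `∏ i, (s i) (a i)`. -/
theorem prod_sum_single_eq_prod (m : ℕ) (s : Fin m → (K →ₐ[ℚ] ℂ)) (a : Fin m → K) :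
    ((∑ i, Finsupp.single (i, s i) 1 : Fin m × (K →ₐ[ℚ] ℂ) →₀ ℕ).prod
      fun q n => q.2 (a q.1) ^ n) = ∏ i, s i (a i) := by
  rw [← Finsupp.prod_finsetSum_index (fun _ => pow_zero _) (fun _ _ _ => pow_add _ _ _)]
  exact Finset.prod_congr rfl fun i _ => by
    rw [Finsupp.prod_single_index (h := fun q : Fin m × (K →ₐ[ℚ] ℂ) => fun n : ℕ => q.2 (a q.1) ^ n)
      (pow_zero _), pow_one]

/-- Distinct tuples of embeddings have distinct exponent vectors. -/
theorem sum_single_injective (m : ℕ) :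
    Function.Injective fun s : Fin m → (K →ₐ[ℚ] ℂ) =>
      (∑ i, Finsupp.single (i, s i) 1 : Fin m × (K →ₐ[ℚ] ℂ) →₀ ℕ) := by
  classical
  intro s t h
  funext i
  have h' := congrArg (fun f : Fin m × (K →ₐ[ℚ] ℂ) →₀ ℕ => f (i, s i)) h
  simp only [Finsupp.coe_finsetSum, Finset.sum_apply, Finsupp.single_apply, Prod.mk.injEq] at h'
  by_contra hst
  have hl : (∑ j : Fin m, if j = i ∧ s j = s i then (1 : ℕ) else 0) = 1 := by
    rw [Finset.sum_eq_single i]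
    · simp
    · intro j _ hj; simp [hj]
    · intro hi; exact absurd (Finset.mem_univ i) hi
  have hr : (∑ j : Fin m, if j = i ∧ t j = s i then (1 : ℕ) else 0) = 0 := by
    refine Finset.sum_eq_zero fun j _ => ?_
    by_cases hj : j = i
    · subst hj; simp [Ne.symm hst]
    · simp [hj]
  rw [hl, hr] at h'
  exact one_ne_zero h'

/-- **The separating correspondence of S3ᴿ / A5 (1) for `m` corners.**  For a finite set `S` of tuples
`s : Fin m → Hom(K,ℂ)` (the characters `∏_i s_i(a_i)` of `(K^×)^m`) there is `a : Fin m → K` at which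
distinct tuples take distinct values: `s ≠ t` in `S` implies `∏ i, s i (a i) ≠ ∏ i, t i (a i)`. -/
theorem exists_separating_tuple (m : ℕ) (S : Finset (Fin m → (K →ₐ[ℚ] ℂ))) :
    ∃ a : Fin m → K, ∀ s ∈ S, ∀ t ∈ S, s ≠ t → ∏ i, s i (a i) ≠ ∏ i, t i (a i) := by
  classical
  obtain ⟨a, ha⟩ := exists_separating_finsupp_pi K m
    (S.image fun s => ∑ i, Finsupp.single (i, s i) 1)
  refine ⟨a, fun s hs t ht hst => ?_⟩
  rw [← prod_sum_single_eq_prod K m s a, ← prod_sum_single_eq_prod K m t a]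
  exact ha _ (Finset.mem_image_of_mem _ hs) _ (Finset.mem_image_of_mem _ ht)
    fun h => hst (sum_single_injective K m h)

/-- **The separating element feeds `Isotypic.exists_partition_of_unity`.**  At the separating `a` of
`exists_separating_multiset`, the linear factors `X − χ_M(a)` (`M ∈ 𝓜`) are pairwise coprime in
`ℂ[X]` — the form in which ROUTE.md A5 (1) / S3ᴿ use the characters ("Lagrange interpolation in
one `a` with pairwise distinct `χ_M(a)`"). -/
theorem exists_separating_multiset_coprime [DecidableEq (K →ₐ[ℚ] ℂ)]
    (𝓜 : Finset (Multiset (K →ₐ[ℚ] ℂ))) :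
    ∃ a : K, (𝓜 : Set (Multiset (K →ₐ[ℚ] ℂ))).Pairwise fun M N =>
      IsCoprime (Polynomial.X - Polynomial.C ((M.map fun σ => σ a).prod))
        (Polynomial.X - Polynomial.C ((N.map fun σ => σ a).prod)) := by
  obtain ⟨a, ha⟩ := exists_separating_multiset K 𝓜
  refine ⟨a, fun M hM N hN hMN => ?_⟩
  exact Polynomial.isCoprime_X_sub_C_of_isUnit_sub
    (isUnit_iff_ne_zero.mpr (sub_ne_zero.mpr (ha M hM N hN hMN)))

/-- The same for tuples of embeddings (the characters of `(K^×)^m`): at the separating `a` of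
`exists_separating_tuple`, the linear factors `X − ∏ᵢ sᵢ(aᵢ)` are pairwise coprime. -/
theorem exists_separating_tuple_coprime (m : ℕ) (S : Finset (Fin m → (K →ₐ[ℚ] ℂ))) :
    ∃ a : Fin m → K, (S : Set (Fin m → (K →ₐ[ℚ] ℂ))).Pairwise fun s t =>
      IsCoprime (Polynomial.X - Polynomial.C (∏ i, s i (a i)))
        (Polynomial.X - Polynomial.C (∏ i, t i (a i))) := by
  obtain ⟨a, ha⟩ := exists_separating_tuple K m S
  refine ⟨a, fun s hs t ht hst => ?_⟩
  exact Polynomial.isCoprime_X_sub_C_of_isUnit_sub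
    (isUnit_iff_ne_zero.mpr (sub_ne_zero.mpr (ha s hs t ht hst)))

end HodgeRepro.Zariski
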